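import Summits.BirchSwinnertonDyer.BirchSwinnertonDyer.Theorems.AdditiveKolyvaginRoadManinFrameResidueProperRTameTwistSymbols57
import Summits.BirchSwinnertonDyer.BirchSwinnertonDyer.Theorems.AdditiveKolyvaginRoadManinFrameResidueProperRTameTwistFull
import HarnessLib

/-!
# Route `AdditiveKolyvaginRoad`, crux `ManinFrameResidueProperR` (stmt-BirchSwinnertonDyer-20709), line
# `tame-twist`, stub S57 (`p ∈ {5, 7}`): Manin's `p`-part at every lattice-optimal datum and the registered stub
# `stub_memberManinUnit_fiveSeven` OFF the Kosters–Pannekoek exceptional sub-residue, GRANTED ONE Literature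
# fact — `--supports`, helper

Cell `pub/bsd-wall`, seat `bsd-wall-manin-p1` g4. THEOREMS ONLY; the published input is the Literature fact
`kato_neron_isIntegral_twistedSymbolSum_of_additive_five_le` (p576988; first-hand audit of the derivation in
memo MEMO-F1-audit-manin-p1-g4.md = evidence #11 on the crux item). MAIN RESULTS: `not_dvd_c_of_tameTwist57`
(fact ∧ `p ∈ {5,7}` ∧ `Addv` ∧ `Irr` ∧ `W(ℚ_p)[p] = 0` ∧ `p² ∣ N` ∧ `a_ℓ = ±1` ⟹ `p ∤ c` at every
lattice-optimal datum), `exists_member_not_dvd_c_of_tameTwist57`, and `stub_memberManinUnit_fiveSeven_of_kato57`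
= the registered stub S57 with its binder list VERBATIM plus `hK` and `hPT` (no member has a `ℚ_p`-rational
point of order `p`; by Kosters–Pannekoek Cor. 2 this is `a₄ ≢ 10 (mod 25)` resp. `a₆ ≢ 14 (mod 49)` on a model
with `a_i ∈ pℤ_p`; cf. the tree's `KimNakamura2020.NonExceptional`). HONEST STATUS: S57 is NOT closed — it is
reduced to (i) the named fact (a derived reading of Kato 2004 (8.1.3)/9.7/6.6 + Kim–Nakamura §2 ⟸
Kosters–Pannekoek; XL to discharge) and (ii) the exceptional sub-residue `W(ℚ_p)[p] ≠ 0` (`p = 5`: Kodaira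
II/III; `p = 7`: type II), where Kato's bound only gives `v_p(c) ≤ 1`. BSD is not proved by any of this.
-/

set_option autoImplicit false
set_option linter.dupNamespace false

noncomputable section

open scoped Classical MatrixGroups

open WeierstrassCurve NumberField Literature.NumberTheory.EllipticCurves
  Literature.NumberTheory.EllipticCurves.ModularForms
  Literature.NumberTheory.EllipticCurves.Rank1Residual
  Literature.NumberTheory.DiophantineGeometry IsDedekindDomain Rat.HeightOneSpectrum
  Summit.BirchSwinnertonDyer.Rank1Residual Summit.BirchSwinnertonDyer.Rank1Residual.Additive
  CongruenceSubgroup Complex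

namespace Summit.BirchSwinnertonDyer.BirchSwinnertonDyer.Theorems.ManinFrameResidueProperRTameTwist

section Main57

variable {p : ℕ} [hp : Fact p.Prime]

/-- **Manin's `p`-part at a lattice-optimal datum, `p ∈ {5, 7}`, off the Kosters–Pannekoek exception.**
Let `W/ℚ` be globally minimal, additive at `p ∈ {5, 7}` with `E[p]` irreducible and `W(ℚ_p)[p] = 0`, `D` a
LATTICE-OPTIMAL datum (`Λ_E = c Λ_f`) at a level `N` with `p² ∣ N`, `a_ℓ(W) = ±1` for `ℓ ∥ N`. GRANTED the
`p ≥ 5` Kato–Kosters–Pannekoek fact: `p ∤ c`. Proof = g3's `not_dvd_c_of_tameTwistL` verbatim with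
`pint_im_cuspSymbol57`. [cite: Kato2004Asterisque, (8.1.3) (p. 180), Thm. 9.7 (p. 189)]
[cite: KimNakamura2020, Cor. 2.4] [cite: KostersPannekoek2017, Thm. 1 and Cor. 2] -/
theorem not_dvd_c_of_tameTwist57 (hK : kato_neron_isIntegral_twistedSymbolSum_of_additive_five_le)
    (hp57 : p = 5 ∨ p = 7)
    (W : WeierstrassCurve ℚ) [W.IsElliptic] [W.IsGloballyMinimal] {N : ℕ} [NeZero N]
    (D : ModularParametrizationData W N)
    (hopt : ∀ z ∈ D.L.lattice, ∃ w ∈ periodLattice D.f, z = D.c * w)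
    (hPT : ∀ P : (W.baseChange ℚ_[p]).toAffine.Point, p • P = 0 → P = 0)
    (hadd : Addv W p) (hirr : Irr W p) (hpN : p ^ 2 ∣ N)
    (ha : ∀ ℓ ∈ N.primeFactors, ¬ ℓ ^ 2 ∣ N → W.LFunction ℓ = 1 ∨ W.LFunction ℓ = -1) :
    ¬ (p : ℤ) ∣ D.c := by
  have hpP : p.Prime := hp.out
  have hp2 : p ≠ 2 := by rcases hp57 with rfl | rfl <;> norm_num
  have hc0 : D.c ≠ 0 := D.maninConstant_ne_zero_holds
  -- the period scalar `ϖ = m/|c|`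
  obtain ⟨mm, -, hmm⟩ :=
    SkinnerUrban2014.exists_dvd_two_mul_imaginaryPeriodRat_eq_of_latticeEq D hopt
  set ϖ : ℚ := (mm : ℚ) / |(D.c : ℚ)| with hϖdef
  have habs0 : |(D.c : ℝ)| ≠ 0 := abs_ne_zero.mpr (by exact_mod_cast hc0)
  have hϖ : (ϖ : ℝ) * W.imaginaryPeriodRat = minusPeriod D.f := by
    rw [hϖdef]; push_cast
    rw [div_mul_eq_mul_div, hmm]
    field_simp
  have hΩf : 0 < minusPeriod D.f :=
    IsNewform0.minusPeriod_pos_holds D.isNewformOf.1 D.isNewformOf.coeffField_eq_bot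
  have hΩ : 0 < W.imaginaryPeriodRat := W.imaginaryPeriodRat_pos
  -- `Ω⁻_f/2 = Im {∞, γ∞}_f` for some `γ`
  have hmem : minusPeriod D.f / 2 ∈ imagPeriods D.f := by
    rw [SkinnerUrban2014.imagPeriods_eq_zmultiples_of_minusPeriod_pos D.f hΩf]
    exact AddSubgroup.mem_zmultiples _
  obtain ⟨z, hz, hzim⟩ := AddSubgroup.mem_map.mp hmem
  have hz' : z ∈ (periodLattice D.f : Set ℂ) := hz
  rw [coe_periodLattice_eq_range] at hz'
  obtain ⟨γ, hγ⟩ := hz'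
  have hP := pint_im_cuspSymbol57 hK hp57 (Or.inr hPT) hadd hirr D.f D.isNewformOf hpN ha hϖ γ
  rw [hγ] at hP
  have hzim' : z.im = minusPeriod D.f / 2 := hzim
  -- `Im z / Ω = ϖ/2`
  have hq : (((z.im : ℝ) : ℂ) / (W.imaginaryPeriodRat : ℂ)) = ((ϖ / 2 : ℚ) : ℂ) := by
    rw [hzim', ← hϖ]
    have hΩ0 : (W.imaginaryPeriodRat : ℂ) ≠ 0 := by exact_mod_cast hΩ.ne'
    push_cast
    field_simp
  rw [hq] at hP
  have hval := padicValRat_nonneg_of_pint hP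
  have hϖ2 : padicValRat p (ϖ / 2) = padicValRat p ϖ := by
    have hϖ0 : ϖ ≠ 0 := by
      rintro h; rw [h, Rat.cast_zero, zero_mul] at hϖ; exact hΩf.ne' hϖ.symm
    rw [padicValRat.div hϖ0 two_ne_zero, show (2 : ℚ) = ((2 : ℕ) : ℚ) by norm_num, padicValRat.of_nat,
      padicValNat.eq_zero_of_not_dvd (fun h ↦ hp2 ((Nat.prime_dvd_prime_iff_eq hpP Nat.prime_two).mp h))]
    simp
  rw [hϖ2, ManinFrameResidueProperRUnitTwist.padicValRat_eq_neg_of_mul_imaginaryPeriodRat_eq hp2 D hopt hϖ]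
    at hval
  exact not_dvd_of_padicValRat_intCast_le_zero hc0 (by linarith)

/-- **At an AKR residue frame with `p ∈ {5, 7}`: a member with a Manin-unit conductor-level datum**, GRANTED the
`p ≥ 5` fact and modularity, when NO member of the class has a `ℚ_p`-rational point of order `p` (the
Kosters–Pannekoek exception; under `Irr` a class invariant): the `X₀(N)`-optimal member (lattice-optimal datum)
has `p ∤ c₀` by `not_dvd_c_of_tameTwist57`. [cite: EdixhovenManin1991, §4 (cases 1/2)]
[cite: KostersPannekoek2017, Thm. 1 and Cor. 2] -/
theorem exists_member_not_dvd_c_of_tameTwist57 (hK : kato_neron_isIntegral_twistedSymbolSum_of_additive_five_le)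
    (hnf : exists_isNewformOf) (W : WeierstrassCurve ℚ) [W.IsElliptic] [W.IsGloballyMinimal]
    [NeZero (W.conductorNorm ℤ)] (hp57 : p = 5 ∨ p = 7) (hadd : Addv W p) (hirr : Irr W p)
    (hPT : ∀ (W' : WeierstrassCurve ℚ) [W'.IsElliptic] [W'.IsGloballyMinimal], IsIsogenous W W' →
      ∀ P : (W'.baseChange ℚ_[p]).toAffine.Point, p • P = 0 → P = 0) :
    ∃ (W₀ : WeierstrassCurve ℚ) (_ : W₀.IsElliptic) (_ : W₀.IsGloballyMinimal)
      (D₀ : ModularParametrizationData W₀ (W.conductorNorm ℤ)),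
      IsIsogenous W W₀ ∧ ¬ (p : ℤ) ∣ D₀.c := by
  obtain ⟨W₀, hE₀, hM₀, hNe₀, D₀'', hiso, hN, hopt''⟩ := X12.exists_isIsogenous_optimal hnf W
  haveI := hE₀
  haveI := hM₀
  haveI := hNe₀
  obtain ⟨D₀', hopt'⟩ := X12.exists_optimalDatum_of_level_eq hN D₀'' hopt''
  have hiso₀ : IsIsogenous W₀ W := hiso.symm_of_charZero
  have hL : W₀.LFunction = W.LFunction := hiso₀.LFunction_eq
  have hadd₀ : Addv W₀ p := (X2.addv_iff_of_isIsogenous (p := p) hiso).mp hadd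
  have hirr₀ : Irr W₀ p := (X12.irr_iff_of_isIsogenous hiso p).mp hirr
  have hpN : p ^ 2 ∣ W.conductorNorm ℤ := sq_dvd_conductorNorm_of_not_good_of_not_mult hadd
  have ha : ∀ ℓ ∈ (W.conductorNorm ℤ).primeFactors, ¬ ℓ ^ 2 ∣ W.conductorNorm ℤ →
      W₀.LFunction ℓ = 1 ∨ W₀.LFunction ℓ = -1 := by
    intro ℓ hℓ hℓ2
    haveI : Fact ℓ.Prime := ⟨Nat.prime_of_mem_primeFactors hℓ⟩
    rw [hL]
    rcases hasGoodReductionAtPrime_or_hasMultiplicativeReductionAtPrime_of_not_sq_dvd_conductorNorm (V := W) hℓ2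
      with hg | hmul
    · exact absurd (Nat.dvd_of_mem_primeFactors hℓ) (not_dvd_conductorNorm_of_hasGoodReductionAtPrime W hg)
    · exact KrausOesterle1992.lFunction_apply_prime_eq_one_or_eq_neg_one_of_mult W ℓ hmul
  exact ⟨W₀, hE₀, hM₀, D₀', hiso, not_dvd_c_of_tameTwist57 hK hp57 W₀ D₀' hopt' (hPT W₀ hiso) hadd₀ hirr₀ hpN ha⟩

/-- **The registered stub `stub_memberManinUnit_fiveSeven` (S57) of lines `birth`/`tame-twist` (crux
`ManinFrameResidueProperR`, stmt-BirchSwinnertonDyer-20709), VERBATIM binder list, GRANTED the `p ≥ 5`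
Kato–Kosters–Pannekoek fact `hK` and OFF the Kosters–Pannekoek exceptional sub-residue (`hPT`: no member has a
`ℚ_p`-rational point of order `p`).** The residue hypothesis `hres` and the «`p ∣ deg φ` for every member»
hypothesis `hall` are not used. So S57 is reduced to: the named fact (XL) + the classes at `p ∈ {5, 7}` with a
local `p`-torsion point (`a₄ ≡ 10 (mod 25)` resp. `a₆ ≡ 14 (mod 49)` on a model with `a_i ∈ pℤ_p`). Nothing is
closed by this theorem. [cite: KostersPannekoek2017, Thm. 1 and Cor. 2] -/
theorem stub_memberManinUnit_fiveSeven_of_kato57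
    (hK : kato_neron_isIntegral_twistedSymbolSum_of_additive_five_le)
    (hnf : Literature.NumberTheory.EllipticCurves.ModularForms.exists_isNewformOf)
    (W : WeierstrassCurve ℚ) [W.IsElliptic] [W.IsGloballyMinimal] (hp5 : 5 ≤ p) (hp11 : p < 11)
    [NeZero (W.conductorNorm ℤ)] (hadd : Addv W p) (hirr : Irr W p)
    (_hres : ((p < 11 ∨ ∃ (W' : WeierstrassCurve ℚ) (_ : W'.IsElliptic) (_ : W'.IsGloballyMinimal),
          IsIsogenous W W' ∧ TypeGOrd W' p ∧ padicValInt p W'.minimalDiscriminantInt ≤ 4) ∧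
        (∃ (W' : WeierstrassCurve ℚ) (_ : W'.IsElliptic) (_ : W'.IsGloballyMinimal),
          IsIsogenous W W' ∧ ∀ (v : HeightOneSpectrum ℤ) (n : ℕ), natGenerator v = p →
            W'.kodairaSymbolAt v ≠ KodairaSymbol.Istar n)))
    (_hall : (∀ (W' : WeierstrassCurve ℚ) [W'.IsElliptic] [W'.IsGloballyMinimal]
          (D' : ModularParametrizationData W' (W.conductorNorm ℤ)),
          IsIsogenous W W' → p ∣ D'.modularDegree))
    (hPT : ∀ (W' : WeierstrassCurve ℚ) [W'.IsElliptic] [W'.IsGloballyMinimal], IsIsogenous W W' →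
      ∀ P : (W'.baseChange ℚ_[p]).toAffine.Point, p • P = 0 → P = 0) :
    ∃ (W₀ : WeierstrassCurve ℚ) (_ : W₀.IsElliptic) (_ : W₀.IsGloballyMinimal)
        (D₀ : ModularParametrizationData W₀ (W.conductorNorm ℤ)),
        IsIsogenous W W₀ ∧ ¬ (p : ℤ) ∣ D₀.c := by
  have hpP : p.Prime := hp.out
  have hp57 : p = 5 ∨ p = 7 := by
    interval_cases p
    · exact Or.inl rfl
    · exact absurd hpP (by decide)
    · exact Or.inr rfl
    · exact absurd hpP (by decide)
    · exact absurd hpP (by decide)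
    · exact absurd hpP (by decide)
  exact exists_member_not_dvd_c_of_tameTwist57 hK hnf W hp57 hadd hirr hPT

end Main57

end Summit.BirchSwinnertonDyer.BirchSwinnertonDyer.Theorems.ManinFrameResidueProperRTameTwist

end
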